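import Summits.ResolutionOfSingularities.ResolutionOfSingularities.Theorems.RadicialJungCleanModelsStubCossartPiltant2019LeavesQuotientLU
import Summits.ResolutionOfSingularities.ResolutionOfSingularities.Theorems.CossartPiltant2019PrincipalizationHolds
import Literature.AlgebraicGeometry.Resolution.ArithmeticalThreefoldsLocalDescentEmbChain6
import Literature.AlgebraicGeometry.Resolution.LUCompleteDimLETwo
import HarnessLib

/-!
# `CleanModels`, stub 2 (F-02) at characteristic `p`: the leaf list CLOSED DOWN to
# {`CossartPiltant2019Local` (printed), stub 1 (printed), `hEqT`, `hEqI` (research)} — no geometric-head leaf, no (LU) leaf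

OURS (decomp-res hand-1 g19; crux `stmt-ResolutionOfSingularities-15917`, skeleton rev 35
`Cruxes/CleanModels/Lines/Sketch.lean`, stub `stub_cossartPiltant2019 : CossartPiltant2019.{0}`). A BOOKKEEPING file continuing
`RadicialJungCleanModelsStubCossartPiltant2019LeavesQuotientLU.lean`: its remaining new hypothesis `hLU2` ((LU) for complete
Noetherian local domains of dimension `≤ 2`) is now a THEOREM of stub 1
(`cpLocalUniformization_of_isAdicComplete_of_ringKrullDim_le_two`, `Literature/AlgebraicGeometry/Resolution/LUCompleteDimLETwo.lean`:
Cohen presentation + CJS Thm. 1.4 over the regular excellent base + valuative criterion), so the `k`-instance of stub 2 at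
characteristic `p` follows from:

* `localUniformization3_of_stub1_of_luComplete3_charP` — stub 1 + (LU) for complete Noetherian local domains of dimension THREE
  with residue field of characteristic `p` (the only input beyond stub 1);
* `localUniformization3_of_stub1_of_reductionP_charP'` — stub 1 + `CossartPiltant2019Local` + `CossartPiltant2019ReductionP`;
* `localUniformization3_of_stub1_of_equivariantLU_charP` — stub 1 + `CossartPiltant2019Local` + the two research leaves `hEqT`,
  `hEqI` (equivariant local uniformization in the tame and in the inseparable layer of Cossart–Piltant's Prop. 4.10 climb), verbatim
  the hypotheses of `cossartPiltant2019ReductionP_of_embPrinted_of_equivariantLU_split` — compared with hand-1 g17's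
  `localUniformization3_of_stub1_of_leaves_charP` the hypothesis `hhead` (geometric head of CP 2019 Prop. 4.8) is GONE, proved;
* the corresponding `resolutionOverUpToDim_three_…` statements (`ResolutionOverUpToDim k 3`, the `k`-instance of F-02) by the
  proved patching.

Nothing here proves resolution of singularities in positive characteristic, local uniformization in dimension three, or any
statement of a manuscript under adjudication; rung 0. AI-written; AI review weaker than expert review.
-/

-- `Summit.<Summit>.<Sub>.Theorems` with `Sub = Summit` (single-conjunct summit, D-0017)
set_option linter.dupNamespace false

noncomputable section

open IsLocalRing Polynomial
open Literature.AlgebraicGeometry.Resolution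
open Summit.ResolutionOfSingularities.ResolutionOfSingularities.Theorems.CP2008Prop44

namespace Summit.ResolutionOfSingularities.ResolutionOfSingularities.Theorems.RadicialJung.CleanModels

/-- **`LocalUniformization3 k` (`CharP k p`) from stub 1 and (LU) for complete three-dimensional local domains of residue
characteristic `p`** — `localUniformization3_of_stub1_of_luComplete_charP` with its dimension-`≤ 2` input discharged by
`cpLocalUniformization_of_isAdicComplete_of_ringKrullDim_le_two` (CJS Thm. 1.4 = stub 1).
[cite: CossartPiltant2019, Thm. 1.5, Props. 4.8 (with Lemma 4.7), 4.10] [cite: CossartJannsenSaito2020, Thm. 1.2, Thm. 1.4, Cor. 1.5]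
[cite: NovacoskiSpivakovsky2014, Thm. 1.1, Cor. 2.17, §3.1] -/
theorem localUniformization3_of_stub1_of_luComplete3_charP (p : ℕ) (hp : p.Prime)
    (hCJSE : CossartJannsenSaito2020Embedded.{0})
    (hLU3 : ∀ (A : Type) [CommRing A] [IsDomain A] [IsLocalRing A] [IsNoetherianRing A]
        [IsAdicComplete (maximalIdeal A) A],
        ringKrullDim A = 3 → CharP (ResidueField A) p → CPLocalUniformization A)
    (k : Type) [Field k] [CharP k p] : LocalUniformization3 k :=
  localUniformization3_of_stub1_of_luComplete_charP p hp hCJSE hLU3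
    (fun A _ _ _ _ _ hdim _ => cpLocalUniformization_of_isAdicComplete_of_ringKrullDim_le_two hCJSE A hdim) k

/-- **`ResolutionOverUpToDim k 3` (`CharP k p`) from stub 1 and (LU) for complete three-dimensional local domains of residue
characteristic `p`**, by the proved patching. [cite: CossartPiltant2019, Thm. 1.1, Props. 4.6, 4.8, 4.10]
[cite: CossartJannsenSaito2020, Thm. 1.2, Thm. 1.4] -/
theorem resolutionOverUpToDim_three_of_stub1_of_luComplete3_charP (p : ℕ) (hp : p.Prime)
    (hCJSE : CossartJannsenSaito2020Embedded.{0})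
    (hLU3 : ∀ (A : Type) [CommRing A] [IsDomain A] [IsLocalRing A] [IsNoetherianRing A]
        [IsAdicComplete (maximalIdeal A) A],
        ringKrullDim A = 3 → CharP (ResidueField A) p → CPLocalUniformization A)
    (k : Type) [Field k] [CharP k p] : ResolutionOverUpToDim.{0} k 3 :=
  CossartPiltant2019Patching_holds k (cossartJannsenSaito2020_of_embedded hCJSE k)
    (localUniformization3_of_stub1_of_luComplete3_charP p hp hCJSE hLU3 k)

/-- **`LocalUniformization3 k` (`CharP k p`) from stub 1, `CossartPiltant2019Local` and `CossartPiltant2019ReductionP`** (the latter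
a theorem of the tree from `CossartPiltant2019Local`, `CossartPiltant2019Principalization` (proved), stub 1, `hEqT`, `hEqI`).
[cite: CossartPiltant2019, Thm. 1.5, Props. 4.8, 4.10] [cite: CossartJannsenSaito2020, Thm. 1.4, Cor. 1.5] -/
theorem localUniformization3_of_stub1_of_reductionP_charP' (p : ℕ) (hp : p.Prime)
    (hloc : CossartPiltant2019Local.{0}) (hRedP : CossartPiltant2019ReductionP.{0})
    (hCJSE : CossartJannsenSaito2020Embedded.{0})
    (k : Type) [Field k] [CharP k p] : LocalUniformization3 k :=
  localUniformization3_of_stub1_of_luComplete3_charP p hp hCJSE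
    (fun A _ _ _ _ _ hdim hchar => hRedP hloc p hp A hdim hchar) k

/-- **`ResolutionOverUpToDim k 3` (`CharP k p`) from stub 1, `CossartPiltant2019Local` and `CossartPiltant2019ReductionP`**, by the
proved patching. [cite: CossartPiltant2019, Thm. 1.1, Thm. 1.5, Props. 4.6, 4.8, 4.10] [cite: CossartJannsenSaito2020, Thm. 1.2, Thm. 1.4] -/
theorem resolutionOverUpToDim_three_of_stub1_of_reductionP_charP' (p : ℕ) (hp : p.Prime)
    (hloc : CossartPiltant2019Local.{0}) (hRedP : CossartPiltant2019ReductionP.{0})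
    (hCJSE : CossartJannsenSaito2020Embedded.{0})
    (k : Type) [Field k] [CharP k p] : ResolutionOverUpToDim.{0} k 3 :=
  CossartPiltant2019Patching_holds k (cossartJannsenSaito2020_of_embedded hCJSE k)
    (localUniformization3_of_stub1_of_reductionP_charP' p hp hloc hRedP hCJSE k)

/-- **`LocalUniformization3 k` (`CharP k p`) from the printed leaves `CossartPiltant2019Local` (CP 2019 Thm. 1.5), stub 1
(CJS Thm. 1.4), and the two research leaves `hEqT`, `hEqI`** (equivariant local uniformization in the tame and in the inseparable
layer of Cossart–Piltant's climb, verbatim the hypotheses of `cossartPiltant2019ReductionP_of_embPrinted_of_equivariantLU_split`;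
principalization `CossartPiltant2019Principalization_holds` is proved in the tree). Compared with hand-1 g17's
`localUniformization3_of_stub1_of_leaves_charP`, the geometric-head hypothesis `hhead` is GONE (proved in kernel, hand-1 g19).
[cite: CossartPiltant2019, Thm. 1.5, Props. 4.4, 4.8 (with Lemma 4.7), 4.10] [cite: CossartPiltant2008, Prop. 8.1, Prop. 9.3, Lemma 9.4]
[cite: CossartJannsenSaito2020, Thm. 1.2, Thm. 1.4, Cor. 1.5] [cite: NovacoskiSpivakovsky2014, Thm. 1.1, Cor. 2.17, §3.1] -/
theorem localUniformization3_of_stub1_of_equivariantLU_charP (p : ℕ) (hp : p.Prime)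
    (hloc : CossartPiltant2019Local.{0}) (hCJSE : CossartJannsenSaito2020Embedded.{0})
    (hEqT :
      ∀ (p : ℕ), p.Prime →
      ∀ (S : Type) [CommRing S] [IsDomain S] [IsRegularLocalRing S],
        IsExcellentRing S → ringKrullDim S = 3 → CharP (ResidueField S) p →
        IsAdicComplete (maximalIdeal S) S →
      ∀ (E : Type) [Field E] [Algebra S E], Function.Injective (algebraMap S E) →
        IsAlgClosed E → Algebra.IsAlgebraic S E →
      ∀ (OE : ValuationSubring E), (∀ s : S, algebraMap S E s ∈ OE) →
        (∀ s ∈ maximalIdeal S, OE.valuation (algebraMap S E s) < 1) →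
        (∀ y : OE, ∃ q : S[X], (∃ i, q.coeff i ∉ maximalIdeal S) ∧
          OE.valuation (q.eval₂ (algebraMap S E) y) < 1) →
      Nonempty OE.valuation.RankOne →
      ∀ (M' : Subfield E), (∀ s : S, algebraMap S E s ∈ M') →
      ∀ (H : Subgroup (E ≃ₐ[S] E)),
        (∀ σ ∈ H, ∀ x ∈ M', σ x ∈ M') →
        (∀ σ ∈ H, ∀ x ∈ M', x ∈ OE → σ x ∈ OE) →
        (∀ σ ∈ H, ∀ x ∈ M', x ∈ OE → OE.valuation (σ x - x) < 1) →
        (∃ ℓ : ℕ, ℓ.Prime ∧ ℓ ≠ p ∧ ∀ σ ∈ H, ∀ x ∈ M', (σ ^ ℓ) x = x) →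
        (∀ σ ∈ H, (∃ x ∈ M', σ x ≠ x) →
          ∃ x ∈ M', x ≠ 0 ∧ OE.valuation (σ x - x) = OE.valuation x) →
        (∃ t : Finset E, (t : Set E) ⊆ M' ∧
          M' ≤ Subfield.closure (Set.range (algebraMap S E) ∪ (t : Set E)) ∧
          ∃ hTO : (Algebra.adjoin S (t : Set E)).toSubring ≤ OE.toSubring,
            IsRegularLocalRing (Localization.AtPrime
              (Ideal.comap (Subring.inclusion hTO) (maximalIdeal OE)))) →
        ∃ t : Finset E, (t : Set E) ⊆ M' ∧
          M' ≤ Subfield.closure (Set.range (algebraMap S E) ∪ (t : Set E)) ∧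
          ∃ hTO : (Algebra.adjoin S (t : Set E)).toSubring ≤ OE.toSubring,
            IsRegularLocalRing (Localization.AtPrime
              (Ideal.comap (Subring.inclusion hTO) (maximalIdeal OE))) ∧
            (∀ σ ∈ H, ∀ x ∈ locAtCentre (Algebra.adjoin S (t : Set E)).toSubring OE,
              σ x ∈ locAtCentre (Algebra.adjoin S (t : Set E)).toSubring OE))
    (hEqI :
      ∀ (p : ℕ), p.Prime →
      ∀ (S : Type) [CommRing S] [IsDomain S] [IsRegularLocalRing S],
        IsExcellentRing S → ringKrullDim S = 3 → CharP (ResidueField S) p →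
        IsAdicComplete (maximalIdeal S) S →
      ∀ (E : Type) [Field E] [Algebra S E], Function.Injective (algebraMap S E) →
        IsAlgClosed E → Algebra.IsAlgebraic S E →
      ∀ (OE : ValuationSubring E), (∀ s : S, algebraMap S E s ∈ OE) →
        (∀ s ∈ maximalIdeal S, OE.valuation (algebraMap S E s) < 1) →
        (∀ y : OE, ∃ q : S[X], (∃ i, q.coeff i ∉ maximalIdeal S) ∧
          OE.valuation (q.eval₂ (algebraMap S E) y) < 1) →
      Nonempty OE.valuation.RankOne →
      ∀ (M' : Subfield E), (∀ s : S, algebraMap S E s ∈ M') →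
      ∀ (H : Subgroup (E ≃ₐ[S] E)),
        (∀ σ ∈ H, ∀ x ∈ M', σ x ∈ M') →
        (∀ σ ∈ H, ∀ x ∈ M', x ∈ OE → σ x ∈ OE) →
        (∀ σ ∈ H, (∃ x ∈ M', σ x ≠ x) →
          ∃ x ∈ M', OE.valuation x = 1 ∧ OE.valuation (σ x - x) = 1) →
      ∀ (x₀ : E), x₀ ∈ M' → x₀ ∈ OE →
        (∃ t : Finset E, (t : Set E) ⊆ M' ∧
          M' ≤ Subfield.closure (Set.range (algebraMap S E) ∪ (t : Set E)) ∧
          ∃ hTO : (Algebra.adjoin S (t : Set E)).toSubring ≤ OE.toSubring,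
            IsRegularLocalRing (Localization.AtPrime
              (Ideal.comap (Subring.inclusion hTO) (maximalIdeal OE)))) →
        ∃ t : Finset E, (t : Set E) ⊆ M' ∧
          M' ≤ Subfield.closure (Set.range (algebraMap S E) ∪ (t : Set E)) ∧
          ∃ hTO : (Algebra.adjoin S (t : Set E)).toSubring ≤ OE.toSubring,
            IsRegularLocalRing (Localization.AtPrime
              (Ideal.comap (Subring.inclusion hTO) (maximalIdeal OE))) ∧
            (∀ σ ∈ H, ∀ x ∈ locAtCentre (Algebra.adjoin S (t : Set E)).toSubring OE,
              σ x ∈ locAtCentre (Algebra.adjoin S (t : Set E)).toSubring OE) ∧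
            x₀ ∈ locAtCentre (Algebra.adjoin S (t : Set E)).toSubring OE)
    (k : Type) [Field k] [CharP k p] : LocalUniformization3 k :=
  localUniformization3_of_stub1_of_reductionP_charP' p hp hloc
    (cossartPiltant2019ReductionP_of_embPrinted_of_equivariantLU_split hloc
      CossartPiltant2019Principalization_holds hCJSE hEqT hEqI) hCJSE k

/-- **`ResolutionOverUpToDim k 3` (`CharP k p`) — the `k`-instance of F-02 `CossartPiltant2019` — from `CossartPiltant2019Local`,
stub 1, `hEqT`, `hEqI`**, by the proved patching. [cite: CossartPiltant2019, Thm. 1.1, Thm. 1.5, Props. 4.4, 4.6, 4.8, 4.10]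
[cite: CossartJannsenSaito2020, Thm. 1.2, Thm. 1.4] -/
theorem resolutionOverUpToDim_three_of_stub1_of_equivariantLU_charP (p : ℕ) (hp : p.Prime)
    (hloc : CossartPiltant2019Local.{0}) (hCJSE : CossartJannsenSaito2020Embedded.{0})
    (hEqT :
      ∀ (p : ℕ), p.Prime →
      ∀ (S : Type) [CommRing S] [IsDomain S] [IsRegularLocalRing S],
        IsExcellentRing S → ringKrullDim S = 3 → CharP (ResidueField S) p →
        IsAdicComplete (maximalIdeal S) S →
      ∀ (E : Type) [Field E] [Algebra S E], Function.Injective (algebraMap S E) →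
        IsAlgClosed E → Algebra.IsAlgebraic S E →
      ∀ (OE : ValuationSubring E), (∀ s : S, algebraMap S E s ∈ OE) →
        (∀ s ∈ maximalIdeal S, OE.valuation (algebraMap S E s) < 1) →
        (∀ y : OE, ∃ q : S[X], (∃ i, q.coeff i ∉ maximalIdeal S) ∧
          OE.valuation (q.eval₂ (algebraMap S E) y) < 1) →
      Nonempty OE.valuation.RankOne →
      ∀ (M' : Subfield E), (∀ s : S, algebraMap S E s ∈ M') →
      ∀ (H : Subgroup (E ≃ₐ[S] E)),
        (∀ σ ∈ H, ∀ x ∈ M', σ x ∈ M') →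
        (∀ σ ∈ H, ∀ x ∈ M', x ∈ OE → σ x ∈ OE) →
        (∀ σ ∈ H, ∀ x ∈ M', x ∈ OE → OE.valuation (σ x - x) < 1) →
        (∃ ℓ : ℕ, ℓ.Prime ∧ ℓ ≠ p ∧ ∀ σ ∈ H, ∀ x ∈ M', (σ ^ ℓ) x = x) →
        (∀ σ ∈ H, (∃ x ∈ M', σ x ≠ x) →
          ∃ x ∈ M', x ≠ 0 ∧ OE.valuation (σ x - x) = OE.valuation x) →
        (∃ t : Finset E, (t : Set E) ⊆ M' ∧
          M' ≤ Subfield.closure (Set.range (algebraMap S E) ∪ (t : Set E)) ∧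
          ∃ hTO : (Algebra.adjoin S (t : Set E)).toSubring ≤ OE.toSubring,
            IsRegularLocalRing (Localization.AtPrime
              (Ideal.comap (Subring.inclusion hTO) (maximalIdeal OE)))) →
        ∃ t : Finset E, (t : Set E) ⊆ M' ∧
          M' ≤ Subfield.closure (Set.range (algebraMap S E) ∪ (t : Set E)) ∧
          ∃ hTO : (Algebra.adjoin S (t : Set E)).toSubring ≤ OE.toSubring,
            IsRegularLocalRing (Localization.AtPrime
              (Ideal.comap (Subring.inclusion hTO) (maximalIdeal OE))) ∧
            (∀ σ ∈ H, ∀ x ∈ locAtCentre (Algebra.adjoin S (t : Set E)).toSubring OE,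
              σ x ∈ locAtCentre (Algebra.adjoin S (t : Set E)).toSubring OE))
    (hEqI :
      ∀ (p : ℕ), p.Prime →
      ∀ (S : Type) [CommRing S] [IsDomain S] [IsRegularLocalRing S],
        IsExcellentRing S → ringKrullDim S = 3 → CharP (ResidueField S) p →
        IsAdicComplete (maximalIdeal S) S →
      ∀ (E : Type) [Field E] [Algebra S E], Function.Injective (algebraMap S E) →
        IsAlgClosed E → Algebra.IsAlgebraic S E →
      ∀ (OE : ValuationSubring E), (∀ s : S, algebraMap S E s ∈ OE) →
        (∀ s ∈ maximalIdeal S, OE.valuation (algebraMap S E s) < 1) →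
        (∀ y : OE, ∃ q : S[X], (∃ i, q.coeff i ∉ maximalIdeal S) ∧
          OE.valuation (q.eval₂ (algebraMap S E) y) < 1) →
      Nonempty OE.valuation.RankOne →
      ∀ (M' : Subfield E), (∀ s : S, algebraMap S E s ∈ M') →
      ∀ (H : Subgroup (E ≃ₐ[S] E)),
        (∀ σ ∈ H, ∀ x ∈ M', σ x ∈ M') →
        (∀ σ ∈ H, ∀ x ∈ M', x ∈ OE → σ x ∈ OE) →
        (∀ σ ∈ H, (∃ x ∈ M', σ x ≠ x) →
          ∃ x ∈ M', OE.valuation x = 1 ∧ OE.valuation (σ x - x) = 1) →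
      ∀ (x₀ : E), x₀ ∈ M' → x₀ ∈ OE →
        (∃ t : Finset E, (t : Set E) ⊆ M' ∧
          M' ≤ Subfield.closure (Set.range (algebraMap S E) ∪ (t : Set E)) ∧
          ∃ hTO : (Algebra.adjoin S (t : Set E)).toSubring ≤ OE.toSubring,
            IsRegularLocalRing (Localization.AtPrime
              (Ideal.comap (Subring.inclusion hTO) (maximalIdeal OE)))) →
        ∃ t : Finset E, (t : Set E) ⊆ M' ∧
          M' ≤ Subfield.closure (Set.range (algebraMap S E) ∪ (t : Set E)) ∧
          ∃ hTO : (Algebra.adjoin S (t : Set E)).toSubring ≤ OE.toSubring,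
            IsRegularLocalRing (Localization.AtPrime
              (Ideal.comap (Subring.inclusion hTO) (maximalIdeal OE))) ∧
            (∀ σ ∈ H, ∀ x ∈ locAtCentre (Algebra.adjoin S (t : Set E)).toSubring OE,
              σ x ∈ locAtCentre (Algebra.adjoin S (t : Set E)).toSubring OE) ∧
            x₀ ∈ locAtCentre (Algebra.adjoin S (t : Set E)).toSubring OE)
    (k : Type) [Field k] [CharP k p] : ResolutionOverUpToDim.{0} k 3 :=
  CossartPiltant2019Patching_holds k (cossartJannsenSaito2020_of_embedded hCJSE k)
    (localUniformization3_of_stub1_of_equivariantLU_charP p hp hloc hCJSE hEqT hEqI k)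

end Summit.ResolutionOfSingularities.ResolutionOfSingularities.Theorems.RadicialJung.CleanModels

end
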